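import Literature.MathematicalPhysics.QuantumFieldTheory.Balaban1983to89.Node00.TkNoExpansionStepSucc

/-!
# DAG node N11 — TWO STRUCTURAL FACES OF 11a's BRANCH OPERATORS `𝐓_k(s, S)`: LINEARITY in constants (each generation is a composition of integrals and a
# multiplication) and SCALE-LOCALITY (if the weights of the generations `j < k` and the operand read only the scales `≤ k`, so does `𝐓_k(s,S)Φ` — it does
# not see the variables of the scales `> k` the later generations integrate) — the two facts «the old factors agree» ((3.24) p. 270) is made of

Cell `pub-ymgap`, YM-PLAN Track A (HUMAN RULING D-0062), seat `pub-ymgap-dag-n11-d` (g7; R134 fan-out seat N11 [B14], strategy s2), route `BalabanUVNodes`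
rev 21, item K1⁵ `StabilityBAtRecordR13SepCoP` = stmt-QuantumFields-20294 (helper, count-neutral).  [III] = [Balaban1988Convergent].  Over 11a
`Node00/TkOfRecord` (p~: `genOp`, `tkBranchOfRecord`, `kernelRTOfRecord`) — faces only, nothing of the record touched.

WHY THIS FILE.  The sibling file `BalabanUVNodesN11NoExpansionZetaSpecSucc` proves the (S1ᵀ) identity one level up at a no-expansion new sequence MODULO
the displayed «old-factor agreement» `𝐓_k(init s′,S)[Φ′](U, V′) = κ·𝐓_k(init s′,S)[Φ](U)` for operands with `Φ′ = κ·Φ` reading the fine scales only.  That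
agreement is two elementary properties of the ordered product (2.20) of generations (2.21): (L) each generation `𝐓^{(j)} = V-transport ∘ ζ-weight ∘ A-integral`
is LINEAR IN CONSTANTS (`integral_const_mul` twice), hence so is `𝐓_k(s,S)`; (SL) each generation `j` READS the configuration only through the scale-`j` variables
it integrates, the scale-`(j+1)` variables its δ-constraint targets, its weights and its operand — so if the weights of the generations `j < k` and the operand
are `k`-LOCAL (depend only on the scales `≤ k`), `𝐓_k(s,S)Φ` is `k`-local, in particular takes the same value at the two-scale configuration `(V_k,V_{k+1}) =
(U,V′)` and at the base configuration of `U` (they differ only at scale `k+1`).  Both are proved here for 11a's data of record `genDataOfRecord` (any weight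
family `W`, any sequence, any branch), by induction on the generations.

WHAT THIS FILE PROVES (0 `sorry`, 0 `def`, standard axioms; generic in `V`, the weight family, the sequence and the branch).  §1 `kernelRTOfRecord_const_mul`,
`aOp_const_mul`, `genOp_genDataOfRecord_const_mul`, ★ `tkBranchOfRecord_const_mul` (L).  §2 `multiCfg_update_agree` (bookkeeping on `Function.update`),
`genOp_congr_of_local` (one generation `j` with `k`-local weights and operand is `k`-local, `j+1 ≤ k`), ★ `tkBranchOfRecord_congr_of_local` (SL: `𝐓_i(s,S)Φ` is
`k`-local for `i ≤ k` under `k`-locality of `W.ζ j (Ω_{j+1}ᶜ)` and `W.w j …` for `j < k` and of `Φ`), `pairCfgAt_agree_baseCfg` (the two configurations agree on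
the scales `≤ k`), ★ `tkBranchOfRecord_pairCfgAt_eq_baseCfg`.

HONEST FRAMING.  Count-neutral kernel bookkeeping on the tree's OWN objects (11a's operator algebra); elementary measure-free identities (the integrals are
Bochner integrals, linear in constants unconditionally; locality is pointwise equality of integrands).  Nothing of Bałaban's asserted; N11 NOT discharged;
counts unmoved (typed 28∕28 · discharged 5∕28).  One finite four-torus programme at fixed `ε = L^{−K}`; NOT ℝ⁴, NOT OS, NOT a mass gap, NOT Clay.
Sources: [III] (2.20)–(2.22) p. 258, (3.24) p. 270.
-/

noncomputable section

open MeasureTheory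
open scoped BigOperators Matrix.Norms.L2Operator

namespace Summit.QuantumFields.YangMills.Theorems.BalabanUVNodesN11TkBranchLinearLocal

open Literature.MathematicalPhysics.QuantumFieldTheory.Balaban1983to89 T4Continuum Node00 Node00.Tk DagBinding
open B15DeterminingSets
open T4AdjointCovariance (JCfg insA)

variable {F : T4Family} {N : ℕ} [NeZero N] {V : Type} [NormedAddCommGroup V] [InnerProductSpace ℝ V] [FiniteDimensional ℝ V]
  [MeasurableSpace V] [BorelSpace V]
variable (ν : Stage7Numerics) (M : ℕ) (g : ℕ → ℝ) (K : ℕ) (W : TkWeights F N V K)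

/-! ## §1. (L) LINEARITY IN CONSTANTS of the restricted transport, the A-factor, one generation, the branch operator -/

section Linear

omit [NormedAddCommGroup V] [InnerProductSpace ℝ V] [FiniteDimensional ℝ V] [MeasurableSpace V] [BorelSpace V] in
/-- The restricted kernel transport of record is linear in constants (`integral_const_mul`). [cite: Balaban1988Convergent, (2.21) p.258 (bookkeeping)] -/
theorem kernelRTOfRecord_const_mul (j : ℕ) [DecidableEq (PBond (F.P K) j)] (sV : Finset (PBond (F.P K) j)) (sV' : Finset (PBond (F.P K) (j + 1)))
    (c : ℝ) (f : (↥sV → SU N) → ℝ) (y' : ↥sV' → SU N) :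
    kernelRTOfRecord F N K j sV sV' (fun y => c * f y) y' = c * kernelRTOfRecord F N K j sV sV' f y' := by
  show T4AveragingDisintegration.kernelTransport _ _ _ (fun y => c * f y) y' = c * T4AveragingDisintegration.kernelTransport _ _ _ f y'
  simp only [T4AveragingDisintegration.kernelTransport, integral_const_mul]
  ring

omit [NeZero N] in
/-- The A-factor is linear in constants (`integral_const_mul` on the fluctuation fibre). [cite: Balaban1988Convergent, (2.21) p.258 (bookkeeping)] -/
theorem aOp_const_mul (j : ℕ) [DecidableEq (PBond (F.P K) j)] (sA : Finset (PBond (F.P K) j)) (w : MultiCfg (F.P K) (SU N) V → ℝ)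
    (c : ℝ) (Φ : MultiCfg (F.P K) (SU N) V → ℝ) (ω : MultiCfg (F.P K) (SU N) V) :
    aOp j sA w (fun ω => c * Φ ω) ω = c * aOp j sA w Φ ω := by
  rw [aOp_apply, aOp_apply, ← integral_const_mul]
  refine integral_congr_ae (Filter.Eventually.of_forall fun a => ?_)
  ring

/-- **ONE GENERATION OF RECORD IS LINEAR IN CONSTANTS**: `𝐓^{(j)}(c·Φ) = c·𝐓^{(j)}Φ` for 11a's data of record (V-transport ∘ ζ-weight ∘ A-integral).
[cite: Balaban1988Convergent, (2.21) p.258] -/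
theorem genOp_genDataOfRecord_const_mul {n : ℕ} (s : SeqOfRecord F ν M g K n) (S : ℕ → Set (Site (F.P K) 0)) (j : ℕ)
    {hdec : DecidableEq (PBond (F.P K) j)} (c : ℝ) (Φ : MultiCfg (F.P K) (SU N) V → ℝ) (ω : MultiCfg (F.P K) (SU N) V) :
    genOp j (genDataOfRecord F N V ν M g K W s S j) (fun ω => c * Φ ω) ω = c * genOp j (genDataOfRecord F N V ν M g K W s S j) Φ ω := by
  rw [genOp_apply, genOp_apply, vOp_apply, vOp_apply]
  show kernelRTOfRecord F N K j _ _ _ _ = c * kernelRTOfRecord F N K j _ _ _ _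
  rw [← kernelRTOfRecord_const_mul]
  congr 1
  funext y
  simp only [zetaOp_apply, aOp_const_mul]
  ring

/-- **★ (L) THE BRANCH OPERATOR IS LINEAR IN CONSTANTS**: `𝐓_i(s,S)(c·Φ) = c·𝐓_i(s,S)Φ` for every `i`. [cite: Balaban1988Convergent, (2.20)–(2.21) p.258, (3.24) p.270] -/
theorem tkBranchOfRecord_const_mul {n : ℕ} (s : SeqOfRecord F ν M g K n) (S : ℕ → Set (Site (F.P K) 0)) (c : ℝ)
    (Φ : MultiCfg (F.P K) (SU N) V → ℝ) :
    ∀ (i : ℕ) (ω : MultiCfg (F.P K) (SU N) V),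
      tkBranchOfRecord F N V ν M g K W s S i (fun ω => c * Φ ω) ω = c * tkBranchOfRecord F N V ν M g K W s S i Φ ω
  | 0, _ => rfl
  | i + 1, ω => by
      rw [tkBranchOfRecord_succ, tkBranchOfRecord_succ]
      have hfun : tkBranchOfRecord F N V ν M g K W s S i (fun ω => c * Φ ω) = fun ω => c * tkBranchOfRecord F N V ν M g K W s S i Φ ω :=
        funext fun ω => tkBranchOfRecord_const_mul s S c Φ i ω
      rw [hfun]
      exact genOp_genDataOfRecord_const_mul ν M g K W s S i c _ ω

end Linear

/-! ## §2. (SL) SCALE-LOCALITY: with `k`-local weights below `k` and a `k`-local operand, `𝐓_i(s,S)Φ` is `k`-local (`i ≤ k`) -/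

section Local

omit [NeZero N] [NormedAddCommGroup V] [InnerProductSpace ℝ V] [FiniteDimensional ℝ V] [MeasurableSpace V] [BorelSpace V] in
/-- Bookkeeping: two all-scales configurations agreeing on the scales `≤ k` still agree there after the same update at a scale `j ≤ k` by data that agree.
[cite: Balaban1988Convergent, (2.21) p.258 (bookkeeping)] -/
theorem multiCfg_update_agree {k j : ℕ} {ω ω' : MultiCfg (F.P K) (SU N) V} (h : ∀ i, i ≤ k → ω i = ω' i)
    {c c' : JCfg (F.P K) j (SU N) V} (hc : c = c') :
    ∀ i, i ≤ k → Function.update ω j c i = Function.update ω' j c' i := by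
  intro i hi
  subst hc
  by_cases hij : i = j
  · subst hij
    rw [Function.update_self, Function.update_self]
  · rw [Function.update_of_ne hij, Function.update_of_ne hij, h i hi]

omit [NeZero N] in
/-- **ONE GENERATION WITH `k`-LOCAL WEIGHTS AND OPERAND IS `k`-LOCAL** (`j + 1 ≤ k`): generation `j` reads the configuration through the scale-`j` variables it
updates, the scale-`(j+1)` δ-target, its weights `ζ`, `w` and the operand — all of which agree on configurations agreeing on the scales `≤ k`.
[cite: Balaban1988Convergent, (2.21) p.258] -/
theorem genOp_congr_of_local {k j : ℕ} {hdec : DecidableEq (PBond (F.P K) j)} (D : GenData (F.P K) (SU N) V j) (hj : j + 1 ≤ k)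
    (hζ : ∀ ω ω' : MultiCfg (F.P K) (SU N) V, (∀ i, i ≤ k → ω i = ω' i) → D.ζ ω = D.ζ ω')
    (hw : ∀ ω ω' : MultiCfg (F.P K) (SU N) V, (∀ i, i ≤ k → ω i = ω' i) → D.w ω = D.w ω')
    {Φ : MultiCfg (F.P K) (SU N) V → ℝ} (hΦ : ∀ ω ω' : MultiCfg (F.P K) (SU N) V, (∀ i, i ≤ k → ω i = ω' i) → Φ ω = Φ ω')
    (ω ω' : MultiCfg (F.P K) (SU N) V) (h : ∀ i, i ≤ k → ω i = ω' i) : genOp j D Φ ω = genOp j D Φ ω' := by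
  have hjk : j ≤ k := by omega
  simp only [genOp_apply, vOp_apply]
  rw [h j hjk, h (j + 1) hj]
  congr 1
  funext y
  simp only [zetaOp_apply]
  have hupd : ∀ i, i ≤ k → Function.update ω j (Function.updateFinset (ω' j).1 D.sV y, (ω' j).2) i =
      Function.update ω' j (Function.updateFinset (ω' j).1 D.sV y, (ω' j).2) i := multiCfg_update_agree K h rfl
  rw [hζ _ _ hupd, aOp_apply, aOp_apply]
  congr 1
  refine integral_congr_ae (Filter.Eventually.of_forall fun a => ?_)
  have hj' : Function.update ω j (Function.updateFinset (ω' j).1 D.sV y, (ω' j).2) j =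
      Function.update ω' j (Function.updateFinset (ω' j).1 D.sV y, (ω' j).2) j := by rw [Function.update_self, Function.update_self]
  have hupd2 := multiCfg_update_agree K (j := j) hupd (c := insA D.sA a (Function.update ω j (Function.updateFinset (ω' j).1 D.sV y, (ω' j).2) j))
    (c' := insA D.sA a (Function.update ω' j (Function.updateFinset (ω' j).1 D.sV y, (ω' j).2) j)) (by rw [hj'])
  show D.w _ * Φ _ = D.w _ * Φ _
  rw [hw _ _ hupd2, hΦ _ _ hupd2]

/-- **★ (SL) THE BRANCH OPERATOR OF RECORD IS `k`-LOCAL UP TO GENERATION `k`**: if for every `j < k` the weights `W.ζ j (Ω_{j+1}(s)ᶜ)` and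
`W.w j (Λ_{j+1}(s)) (Λ_{j+1}(s)ᶜ ∩ Ω_{j+1}(s)) (S_{j+1})` are `k`-local and the operand `Φ` is `k`-local, then `𝐓_i(s,S)Φ` is `k`-local for every `i ≤ k`.
[cite: Balaban1988Convergent, (2.20)–(2.21) p.258, (3.24) p.270] -/
theorem tkBranchOfRecord_congr_of_local {n k : ℕ} (s : SeqOfRecord F ν M g K n) (S : ℕ → Set (Site (F.P K) 0))
    (hζ : ∀ j, j < k → ∀ ω ω' : MultiCfg (F.P K) (SU N) V, (∀ i, i ≤ k → ω i = ω' i) →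
      W.ζ j (s.Ω (j + 1))ᶜ ω = W.ζ j (s.Ω (j + 1))ᶜ ω')
    (hw : ∀ j, j < k → ∀ ω ω' : MultiCfg (F.P K) (SU N) V, (∀ i, i ≤ k → ω i = ω' i) →
      W.w j (s.Λ (j + 1)) ((s.Λ (j + 1))ᶜ ∩ s.Ω (j + 1)) (S (j + 1)) ω = W.w j (s.Λ (j + 1)) ((s.Λ (j + 1))ᶜ ∩ s.Ω (j + 1)) (S (j + 1)) ω')
    {Φ : MultiCfg (F.P K) (SU N) V → ℝ} (hΦ : ∀ ω ω' : MultiCfg (F.P K) (SU N) V, (∀ i, i ≤ k → ω i = ω' i) → Φ ω = Φ ω') :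
    ∀ i, i ≤ k → ∀ ω ω' : MultiCfg (F.P K) (SU N) V, (∀ i', i' ≤ k → ω i' = ω' i') →
      tkBranchOfRecord F N V ν M g K W s S i Φ ω = tkBranchOfRecord F N V ν M g K W s S i Φ ω'
  | 0, _, ω, ω', h => hΦ ω ω' h
  | i + 1, hi, ω, ω', h => by
      rw [tkBranchOfRecord_succ]
      have ih : ∀ ω₁ ω₂ : MultiCfg (F.P K) (SU N) V, (∀ i', i' ≤ k → ω₁ i' = ω₂ i') →
          tkBranchOfRecord F N V ν M g K W s S i Φ ω₁ = tkBranchOfRecord F N V ν M g K W s S i Φ ω₂ :=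
        fun ω₁ ω₂ h₁₂ => tkBranchOfRecord_congr_of_local s S hζ hw hΦ i (Nat.le_of_succ_le hi) ω₁ ω₂ h₁₂
      refine genOp_congr_of_local K _ hi ?_ ?_ ih ω ω' h
      · exact hζ i hi
      · exact hw i hi

omit [NeZero N] [InnerProductSpace ℝ V] [FiniteDimensional ℝ V] [MeasurableSpace V] [BorelSpace V] in
/-- The two-scale configuration `(V_k,V_{k+1}) = (U,V′)` and the base configuration of `U` AGREE ON THE SCALES `≤ k` (they differ at scale `k+1` only).
[cite: Balaban1988Convergent, (2.18) p.257, (2.21) p.258 (bookkeeping)] -/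
theorem pairCfgAt_agree_baseCfg (k : ℕ) (V' : GaugeField (F.P K) (k + 1) (SU N)) (U : GaugeField (F.P K) k (SU N)) :
    ∀ i, i ≤ k → pairCfgAt (V := V) k V' U i = baseCfg (V := V) k U i := by
  intro i hi
  by_cases hik : i = k
  · subst hik
    rw [pairCfgAt_self]
    exact Prod.ext (funext fun b => (baseCfg_fst_self (V := V) i U b).symm) (baseCfg_snd (V := V) i i U).symm
  · rw [pairCfgAt_of_ne k V' U hik]
    have hik' : i ≠ k + 1 := by omega
    exact Prod.ext (by rw [baseCfg_fst_of_ne (V := V) hik', baseCfg_fst_of_ne (V := V) hik]) (by rw [baseCfg_snd, baseCfg_snd])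

/-- **★ HENCE `𝐓_k(s,S)Φ (U, V′) = 𝐓_k(s,S)Φ (U)`**: under `k`-locality of the weights below `k` and of `Φ`, the branch operator at generation `k` takes the same
value at the two-scale configuration and at the base configuration — it does not see the new variables `V′`. [cite: Balaban1988Convergent, (3.24) p.270, (2.20)–(2.21) p.258] -/
theorem tkBranchOfRecord_pairCfgAt_eq_baseCfg {n k : ℕ} (s : SeqOfRecord F ν M g K n) (S : ℕ → Set (Site (F.P K) 0))
    (hζ : ∀ j, j < k → ∀ ω ω' : MultiCfg (F.P K) (SU N) V, (∀ i, i ≤ k → ω i = ω' i) →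
      W.ζ j (s.Ω (j + 1))ᶜ ω = W.ζ j (s.Ω (j + 1))ᶜ ω')
    (hw : ∀ j, j < k → ∀ ω ω' : MultiCfg (F.P K) (SU N) V, (∀ i, i ≤ k → ω i = ω' i) →
      W.w j (s.Λ (j + 1)) ((s.Λ (j + 1))ᶜ ∩ s.Ω (j + 1)) (S (j + 1)) ω = W.w j (s.Λ (j + 1)) ((s.Λ (j + 1))ᶜ ∩ s.Ω (j + 1)) (S (j + 1)) ω')
    {Φ : MultiCfg (F.P K) (SU N) V → ℝ} (hΦ : ∀ ω ω' : MultiCfg (F.P K) (SU N) V, (∀ i, i ≤ k → ω i = ω' i) → Φ ω = Φ ω')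
    (V' : GaugeField (F.P K) (k + 1) (SU N)) (U : GaugeField (F.P K) k (SU N)) :
    tkBranchOfRecord F N V ν M g K W s S k Φ (pairCfgAt (V := V) k V' U) = tkBranchOfRecord F N V ν M g K W s S k Φ (baseCfg (V := V) k U) :=
  tkBranchOfRecord_congr_of_local ν M g K W s S hζ hw hΦ k le_rfl _ _ (pairCfgAt_agree_baseCfg K k V' U)

end Local

end Summit.QuantumFields.YangMills.Theorems.BalabanUVNodesN11TkBranchLinearLocal

end
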